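import Mathlib
import Summits.MatrixMultiplication.MatrixMultiplication.Theorems.SnSubsetDichotomyHyperoctahedralThresholdRotationIdentity

/-!
# Twin defects under rotation, LOCAL form: incidences inside a rotation-closed family of pre-pairs
(crux `SnSubsetDichotomy.HyperoctahedralThreshold`, stmt-MatrixMultiplication-10883; siege seat k18, variation "twins ℓ² argument";
`--supports` helper, companion of `…TwinDefects` (global form, p114598) and `…TwinsEll2Local` (local extraction, p116368))

Vocabulary of the line: involutions `μ c` of `Fin n`, `x · z := z.foldl (fun v c => μ c v) x`.  A family `P'` of TWIN PRE-PAIRS of length `ℓ`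
(`hP'`: every `(z, x, y) ∈ P'` has `z` cyclically reduced of length `ℓ` — here only `z.length = ℓ` is used — and `x`, `y` fixed by `z`) is
ROTATION-CLOSED (`hrot`) when `(z.rotate s, x · z.take s, y · z.take s) ∈ P'` for all `(z, x, y) ∈ P'` and `s < ℓ` — e.g. "both trajectories
avoid the set `D`", "both base points outside the dense vertices and …", any conjunction of trajectory-wise conditions.  For such `P'` the
rotation trick of `…TwinDefects` works INSIDE `P'`:

* `selfIncLocal_fst_le` / `selfIncLocal_snd_le`:  `#{((z,x,y),(s,t)) ∈ P' × [ℓ]² : s < t, x·z.take s = x·z.take t} ≤ ℓ · Ret₁(P')`, where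
  `Ret₁(P') := #{((z,p,y),d) ∈ P' × [ℓ] : 0 < d, p·z.take d = p}` (returns of the FIRST point of a member), and the same for the second point;
* `crossIncLocal_le`:  `#{((z,x,y),(s,t)) ∈ P' × [ℓ]² : x·z.take s = y·z.take t} ≤ ℓ · Ξ(P')`,
  `Ξ(P') := #{((z,x,y),e) ∈ P' × [ℓ] : 0 < e, x = y·z.take e}` (members whose first point lies on the trajectory of the second — SLIDES in `P'`);
* `rHitLocal_fst_le` / `rHitLocal_snd_le`:  `#{((z,x,y),t) ∈ P' × [ℓ] : x·z.take t ∈ R} ≤ ℓ · #{(z,x,y) ∈ P' : x ∈ R}`, and for `y`.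

Why: the GLOBAL twin count fails when a dense piece sits inside `R` (memo of this seat, crux NOTES §C4); with `…TwinsEll2Local` these bounds
give the twins ℓ² reduction for any rotation-closed family, e.g. the pre-pairs avoiding `R ∪ D` (then the `R`-hit terms vanish):
`ℓ · (Ret₁ + Ret₂ + Ξ)(P') < |P'| ⇒` a clean `R`-avoiding twin.  Pure finite combinatorics; hypothesis `μ c * μ c = 1`; no definitions.
-/

set_option linter.dupNamespace false

namespace Summit.MatrixMultiplication.MatrixMultiplication.Theorems.HyperoctahedralThreshold

namespace TwinsEll2

open Finset Rotation

variable {n : ℕ}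

section Local

variable (μ : Fin 3 → Equiv.Perm (Fin n)) (hμ : ∀ c, μ c * μ c = 1) (R : Finset (Fin n)) (ℓ : ℕ)
  (P' : Finset (List (Fin 3) × Fin n × Fin n))
  (hP' : ∀ t ∈ P', t.1.length = ℓ ∧ t.1.foldl (fun v c => μ c v) t.2.1 = t.2.1 ∧ t.1.foldl (fun v c => μ c v) t.2.2 = t.2.2 ∧
    t.2.1 ≠ t.2.2)
  (hrot : ∀ t ∈ P', ∀ s < ℓ,
    ((t.1.rotate s, (t.1.take s).foldl (fun v c => μ c v) t.2.1, (t.1.take s).foldl (fun v c => μ c v) t.2.2) :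
      List (Fin 3) × Fin n × Fin n) ∈ P')

include hμ hP' hrot

/-- **Self-coincidences of the first point, inside `P'`, are `ℓ ×` returns of the first point.** -/
theorem selfIncLocal_fst_le :
    ((P' ×ˢ range ℓ ×ˢ range ℓ).filter (fun a => a.2.1 < a.2.2 ∧
        (a.1.1.take a.2.1).foldl (fun v c => μ c v) a.1.2.1 = (a.1.1.take a.2.2).foldl (fun v c => μ c v) a.1.2.1)).card ≤
      ℓ * ((P' ×ˢ range ℓ).filter (fun a => 0 < a.2 ∧
        (a.1.1.take a.2).foldl (fun v c => μ c v) a.1.2.1 = a.1.2.1)).card := by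
  rw [← card_range ℓ, ← card_product]
  rw [card_range ℓ]
  -- trajectory along a rotated word (the statement of `TwinsEll2.foldl_take_rotate` of `…TwinDefects`, proved inline)
  have key : ∀ {z : List (Fin 3)} {y : Fin n}, z.foldl (fun v c => μ c v) y = y → ∀ {s e : ℕ}, s < z.length → e < z.length →
      ((z.rotate s).take e).foldl (fun v c => μ c v) ((z.take s).foldl (fun v c => μ c v) y) =
        (z.take ((s + e) % z.length)).foldl (fun v c => μ c v) y := by
    intro z y hy s e hs he
    rw [← List.foldl_append, List.rotate_eq_drop_append_take hs.le, List.take_append, List.length_drop,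
      List.take_take, ← List.append_assoc, ← List.take_add]
    rcases lt_or_ge (s + e) z.length with h | h
    · have h1 : min (e - (z.length - s)) s = 0 := by omega
      rw [h1, List.take_zero, List.append_nil, Nat.mod_eq_of_lt h]
    · have h1 : min (e - (z.length - s)) s = s + e - z.length := by omega
      have h2 : (s + e) % z.length = s + e - z.length := by
        rw [Nat.mod_eq_sub_mod h, Nat.mod_eq_of_lt (by omega)]
      rw [h1, h2, List.foldl_append, List.take_of_length_le h, hy]
  refine card_le_card_of_injOn
    (fun a => (a.2.1, ((a.1.1.rotate a.2.1, (a.1.1.take a.2.1).foldl (fun v c => μ c v) a.1.2.1,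
      (a.1.1.take a.2.1).foldl (fun v c => μ c v) a.1.2.2), a.2.2 - a.2.1))) ?_ ?_
  · rintro ⟨⟨z, x, y⟩, s, t⟩ h
    rw [mem_coe, mem_filter] at h
    obtain ⟨hmem, hst, hcoin⟩ := h
    simp only [mem_product, mem_range] at hmem
    obtain ⟨hzP, hs, ht⟩ := hmem
    dsimp only at hst hcoin hs ht
    obtain ⟨hzl, hx, -, -⟩ := hP' _ hzP
    dsimp only at hzl hx
    simp only
    rw [mem_coe, mem_product, mem_filter]
    simp only [mem_product, mem_range]
    refine ⟨hs, ⟨hrot _ hzP s hs, by omega⟩, by omega, ?_⟩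
    rw [key hx (by omega) (by omega)]
    have : (s + (t - s)) % z.length = t := by
      rw [Nat.add_sub_cancel' hst.le, Nat.mod_eq_of_lt (by omega)]
    rw [this]
    exact hcoin.symm
  · rintro ⟨⟨z₁, x₁, y₁⟩, s₁, t₁⟩ h₁ ⟨⟨z₂, x₂, y₂⟩, s₂, t₂⟩ h₂ heq
    rw [mem_coe, mem_filter] at h₁ h₂
    simp only [Prod.mk.injEq] at heq
    obtain ⟨hs, ⟨hz, hx, hy⟩, hd⟩ := heq
    subst hs
    have hz' : z₁ = z₂ := List.rotate_eq_rotate.1 hz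
    subst hz'
    have hx' : x₁ = x₂ := foldl_act_injective μ hμ (z₁.take s₁) hx
    have hy' : y₁ = y₂ := foldl_act_injective μ hμ (z₁.take s₁) hy
    subst hx' hy'
    have ht : t₁ = t₂ := by
      have h1 := h₁.2.1
      have h2 := h₂.2.1
      dsimp only at h1 h2
      omega
    rw [ht]

/-- **Self-coincidences of the second point, inside `P'`, are `ℓ ×` returns of the second point.** -/
theorem selfIncLocal_snd_le :
    ((P' ×ˢ range ℓ ×ˢ range ℓ).filter (fun a => a.2.1 < a.2.2 ∧
        (a.1.1.take a.2.1).foldl (fun v c => μ c v) a.1.2.2 = (a.1.1.take a.2.2).foldl (fun v c => μ c v) a.1.2.2)).card ≤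
      ℓ * ((P' ×ˢ range ℓ).filter (fun a => 0 < a.2 ∧
        (a.1.1.take a.2).foldl (fun v c => μ c v) a.1.2.2 = a.1.2.2)).card := by
  rw [← card_range ℓ, ← card_product]
  rw [card_range ℓ]
  -- trajectory along a rotated word (the statement of `TwinsEll2.foldl_take_rotate` of `…TwinDefects`, proved inline)
  have key : ∀ {z : List (Fin 3)} {y : Fin n}, z.foldl (fun v c => μ c v) y = y → ∀ {s e : ℕ}, s < z.length → e < z.length →
      ((z.rotate s).take e).foldl (fun v c => μ c v) ((z.take s).foldl (fun v c => μ c v) y) =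
        (z.take ((s + e) % z.length)).foldl (fun v c => μ c v) y := by
    intro z y hy s e hs he
    rw [← List.foldl_append, List.rotate_eq_drop_append_take hs.le, List.take_append, List.length_drop,
      List.take_take, ← List.append_assoc, ← List.take_add]
    rcases lt_or_ge (s + e) z.length with h | h
    · have h1 : min (e - (z.length - s)) s = 0 := by omega
      rw [h1, List.take_zero, List.append_nil, Nat.mod_eq_of_lt h]
    · have h1 : min (e - (z.length - s)) s = s + e - z.length := by omega
      have h2 : (s + e) % z.length = s + e - z.length := by
        rw [Nat.mod_eq_sub_mod h, Nat.mod_eq_of_lt (by omega)]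
      rw [h1, h2, List.foldl_append, List.take_of_length_le h, hy]
  refine card_le_card_of_injOn
    (fun a => (a.2.1, ((a.1.1.rotate a.2.1, (a.1.1.take a.2.1).foldl (fun v c => μ c v) a.1.2.1,
      (a.1.1.take a.2.1).foldl (fun v c => μ c v) a.1.2.2), a.2.2 - a.2.1))) ?_ ?_
  · rintro ⟨⟨z, x, y⟩, s, t⟩ h
    rw [mem_coe, mem_filter] at h
    obtain ⟨hmem, hst, hcoin⟩ := h
    simp only [mem_product, mem_range] at hmem
    obtain ⟨hzP, hs, ht⟩ := hmem
    dsimp only at hst hcoin hs ht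
    obtain ⟨hzl, -, hy, -⟩ := hP' _ hzP
    dsimp only at hzl hy
    simp only
    rw [mem_coe, mem_product, mem_filter]
    simp only [mem_product, mem_range]
    refine ⟨hs, ⟨hrot _ hzP s hs, by omega⟩, by omega, ?_⟩
    rw [key hy (by omega) (by omega)]
    have : (s + (t - s)) % z.length = t := by
      rw [Nat.add_sub_cancel' hst.le, Nat.mod_eq_of_lt (by omega)]
    rw [this]
    exact hcoin.symm
  · rintro ⟨⟨z₁, x₁, y₁⟩, s₁, t₁⟩ h₁ ⟨⟨z₂, x₂, y₂⟩, s₂, t₂⟩ h₂ heq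
    rw [mem_coe, mem_filter] at h₁ h₂
    simp only [Prod.mk.injEq] at heq
    obtain ⟨hs, ⟨hz, hx, hy⟩, hd⟩ := heq
    subst hs
    have hz' : z₁ = z₂ := List.rotate_eq_rotate.1 hz
    subst hz'
    have hx' : x₁ = x₂ := foldl_act_injective μ hμ (z₁.take s₁) hx
    have hy' : y₁ = y₂ := foldl_act_injective μ hμ (z₁.take s₁) hy
    subst hx' hy'
    have ht : t₁ = t₂ := by
      have h1 := h₁.2.1
      have h2 := h₂.2.1
      dsimp only at h1 h2
      omega
    rw [ht]

/-- **Crossings inside `P'` are `ℓ ×` slides inside `P'`** (members whose first point lies on the trajectory of the second). -/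
theorem crossIncLocal_le :
    ((P' ×ˢ range ℓ ×ˢ range ℓ).filter (fun a =>
        (a.1.1.take a.2.1).foldl (fun v c => μ c v) a.1.2.1 = (a.1.1.take a.2.2).foldl (fun v c => μ c v) a.1.2.2)).card ≤
      ℓ * ((P' ×ˢ range ℓ).filter (fun a => 0 < a.2 ∧
        a.1.2.1 = (a.1.1.take a.2).foldl (fun v c => μ c v) a.1.2.2)).card := by
  rw [← card_range ℓ, ← card_product]
  rw [card_range ℓ]
  -- trajectory along a rotated word (the statement of `TwinsEll2.foldl_take_rotate` of `…TwinDefects`, proved inline)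
  have key : ∀ {z : List (Fin 3)} {y : Fin n}, z.foldl (fun v c => μ c v) y = y → ∀ {s e : ℕ}, s < z.length → e < z.length →
      ((z.rotate s).take e).foldl (fun v c => μ c v) ((z.take s).foldl (fun v c => μ c v) y) =
        (z.take ((s + e) % z.length)).foldl (fun v c => μ c v) y := by
    intro z y hy s e hs he
    rw [← List.foldl_append, List.rotate_eq_drop_append_take hs.le, List.take_append, List.length_drop,
      List.take_take, ← List.append_assoc, ← List.take_add]
    rcases lt_or_ge (s + e) z.length with h | h
    · have h1 : min (e - (z.length - s)) s = 0 := by omega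
      rw [h1, List.take_zero, List.append_nil, Nat.mod_eq_of_lt h]
    · have h1 : min (e - (z.length - s)) s = s + e - z.length := by omega
      have h2 : (s + e) % z.length = s + e - z.length := by
        rw [Nat.mod_eq_sub_mod h, Nat.mod_eq_of_lt (by omega)]
      rw [h1, h2, List.foldl_append, List.take_of_length_le h, hy]
  refine card_le_card_of_injOn
    (fun a => (a.2.1, ((a.1.1.rotate a.2.1, (a.1.1.take a.2.1).foldl (fun v c => μ c v) a.1.2.1,
      (a.1.1.take a.2.1).foldl (fun v c => μ c v) a.1.2.2), (a.2.2 + (ℓ - a.2.1)) % ℓ))) ?_ ?_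
  · rintro ⟨⟨z, x, y⟩, s, t⟩ h
    rw [mem_coe, mem_filter] at h
    obtain ⟨hmem, hcoin⟩ := h
    simp only [mem_product, mem_range] at hmem
    obtain ⟨hzP, hs, ht⟩ := hmem
    dsimp only at hcoin hs ht
    obtain ⟨hzl, hx, hy, hxy⟩ := hP' _ hzP
    dsimp only at hzl hx hy hxy
    have hℓ : 0 < ℓ := by omega
    have hst : s ≠ t := by
      rintro rfl
      exact hxy (foldl_act_injective μ hμ (z.take s) hcoin)
    have he : (t + (ℓ - s)) % ℓ < ℓ := Nat.mod_lt _ hℓ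
    have hse : (s + (t + (ℓ - s)) % ℓ) % ℓ = t := by
      rw [Nat.add_mod, Nat.mod_mod, ← Nat.add_mod, ← Nat.add_assoc, Nat.add_comm s t, Nat.add_assoc,
        Nat.add_sub_cancel' hs.le, Nat.add_mod_right, Nat.mod_eq_of_lt ht]
    simp only
    rw [mem_coe, mem_product, mem_filter]
    simp only [mem_product, mem_range]
    refine ⟨hs, ⟨hrot _ hzP s hs, he⟩, ?_, ?_⟩
    · rcases Nat.eq_zero_or_pos ((t + (ℓ - s)) % ℓ) with h0 | h0
      · exfalso
        apply hst
        rw [h0, Nat.add_zero, Nat.mod_eq_of_lt hs] at hse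
        exact hse
      · exact h0
    · rw [key hy (by omega) (by rw [hzl]; exact he), hzl, hse]
      exact hcoin
  · rintro ⟨⟨z₁, x₁, y₁⟩, s₁, t₁⟩ h₁ ⟨⟨z₂, x₂, y₂⟩, s₂, t₂⟩ h₂ heq
    rw [mem_coe, mem_filter] at h₁ h₂
    simp only [Prod.mk.injEq] at heq
    obtain ⟨hs, ⟨hz, hx, hy⟩, he⟩ := heq
    subst hs
    have hz' : z₁ = z₂ := List.rotate_eq_rotate.1 hz
    subst hz'
    have hx' : x₁ = x₂ := foldl_act_injective μ hμ (z₁.take s₁) hx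
    have hy' : y₁ = y₂ := foldl_act_injective μ hμ (z₁.take s₁) hy
    subst hx' hy'
    obtain ⟨hmem₁, -⟩ := h₁
    obtain ⟨hmem₂, -⟩ := h₂
    simp only [mem_product, mem_range] at hmem₁ hmem₂
    obtain ⟨-, hs, ht₁⟩ := hmem₁
    obtain ⟨-, -, ht₂⟩ := hmem₂
    have hrec : ∀ t < ℓ, (s₁ + (t + (ℓ - s₁)) % ℓ) % ℓ = t := fun t ht => by
      rw [Nat.add_mod, Nat.mod_mod, ← Nat.add_mod, ← Nat.add_assoc, Nat.add_comm s₁ t, Nat.add_assoc,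
        Nat.add_sub_cancel' hs.le, Nat.add_mod_right, Nat.mod_eq_of_lt ht]
    have ht : t₁ = t₂ := by rw [← hrec t₁ ht₁, ← hrec t₂ ht₂, he]
    rw [ht]

omit hP' in
/-- **`R`-hits of the first point, inside `P'`, are `ℓ ×` the members based in `R`.** -/
theorem rHitLocal_fst_le :
    ((P' ×ˢ range ℓ).filter (fun a => (a.1.1.take a.2).foldl (fun v c => μ c v) a.1.2.1 ∈ R)).card ≤
      ℓ * (P'.filter (fun t => t.2.1 ∈ R)).card := by
  rw [← card_range ℓ, ← card_product]
  rw [card_range ℓ]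
  refine card_le_card_of_injOn
    (fun a => (a.2, (a.1.1.rotate a.2, (a.1.1.take a.2).foldl (fun v c => μ c v) a.1.2.1,
      (a.1.1.take a.2).foldl (fun v c => μ c v) a.1.2.2))) ?_ ?_
  · rintro ⟨⟨z, x, y⟩, t⟩ h
    rw [mem_coe, mem_filter] at h
    obtain ⟨hmem, hR⟩ := h
    simp only [mem_product, mem_range] at hmem
    obtain ⟨hzP, ht⟩ := hmem
    dsimp only at hR ht
    simp only
    rw [mem_coe, mem_product, mem_filter]
    exact ⟨mem_range.2 ht, hrot _ hzP t ht, hR⟩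
  · rintro ⟨⟨z₁, x₁, y₁⟩, t₁⟩ - ⟨⟨z₂, x₂, y₂⟩, t₂⟩ - heq
    simp only [Prod.mk.injEq] at heq
    obtain ⟨ht, hz, hx, hy⟩ := heq
    subst ht
    have hz' : z₁ = z₂ := List.rotate_eq_rotate.1 hz
    subst hz'
    rw [foldl_act_injective μ hμ (z₁.take t₁) hx, foldl_act_injective μ hμ (z₁.take t₁) hy]

omit hP' in
/-- **`R`-hits of the second point, inside `P'`, are `ℓ ×` the members whose second point is in `R`.** -/
theorem rHitLocal_snd_le :
    ((P' ×ˢ range ℓ).filter (fun a => (a.1.1.take a.2).foldl (fun v c => μ c v) a.1.2.2 ∈ R)).card ≤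
      ℓ * (P'.filter (fun t => t.2.2 ∈ R)).card := by
  rw [← card_range ℓ, ← card_product]
  rw [card_range ℓ]
  refine card_le_card_of_injOn
    (fun a => (a.2, (a.1.1.rotate a.2, (a.1.1.take a.2).foldl (fun v c => μ c v) a.1.2.1,
      (a.1.1.take a.2).foldl (fun v c => μ c v) a.1.2.2))) ?_ ?_
  · rintro ⟨⟨z, x, y⟩, t⟩ h
    rw [mem_coe, mem_filter] at h
    obtain ⟨hmem, hR⟩ := h
    simp only [mem_product, mem_range] at hmem
    obtain ⟨hzP, ht⟩ := hmem
    dsimp only at hR ht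
    simp only
    rw [mem_coe, mem_product, mem_filter]
    exact ⟨mem_range.2 ht, hrot _ hzP t ht, hR⟩
  · rintro ⟨⟨z₁, x₁, y₁⟩, t₁⟩ - ⟨⟨z₂, x₂, y₂⟩, t₂⟩ - heq
    simp only [Prod.mk.injEq] at heq
    obtain ⟨ht, hz, hx, hy⟩ := heq
    subst ht
    have hz' : z₁ = z₂ := List.rotate_eq_rotate.1 hz
    subst hz'
    rw [foldl_act_injective μ hμ (z₁.take t₁) hx, foldl_act_injective μ hμ (z₁.take t₁) hy]

end Local

/-- **Registered form** (`stub_twinCrossRotationLocal`, a `--supports` sub-goal of crux stmt-MatrixMultiplication-10883): inside any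
rotation-closed family `P'` of twin pre-pairs of length `ℓ`, crossings number at most `ℓ ×` the slides of `P'` (`crossIncLocal_le`). -/
theorem stub_twinCrossRotationLocal : ∀ (n ℓ : ℕ) (μ : Fin 3 → Equiv.Perm (Fin n)) (P' : Finset (List (Fin 3) × Fin n × Fin n)), (∀ c, μ c * μ c = 1) → (∀ t ∈ P', t.1.length = ℓ ∧ t.1.foldl (fun v c => μ c v) t.2.1 = t.2.1 ∧ t.1.foldl (fun v c => μ c v) t.2.2 = t.2.2 ∧ t.2.1 ≠ t.2.2) → (∀ t ∈ P', ∀ s < ℓ, ((t.1.rotate s, (t.1.take s).foldl (fun v c => μ c v) t.2.1, (t.1.take s).foldl (fun v c => μ c v) t.2.2) : List (Fin 3) × Fin n × Fin n) ∈ P') → ((P' ×ˢ Finset.range ℓ ×ˢ Finset.range ℓ).filter (fun a => (a.1.1.take a.2.1).foldl (fun v c => μ c v) a.1.2.1 = (a.1.1.take a.2.2).foldl (fun v c => μ c v) a.1.2.2)).card ≤ ℓ * ((P' ×ˢ Finset.range ℓ).filter (fun a => 0 < a.2 ∧ a.1.2.1 = (a.1.1.take a.2).foldl (fun v c => μ c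 v) a.1.2.2)).card :=
  fun _ ℓ μ P' hμ hP' hrot => crossIncLocal_le μ hμ ℓ P' hP' hrot

end TwinsEll2

end Summit.MatrixMultiplication.MatrixMultiplication.Theorems.HyperoctahedralThreshold
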